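import Literature.IUT.HodgeTheaters.ThetaPMEllNFHodgeTheatersD
import Literature.IUT.HodgeTheaters.KitCoreLabCusp
import HarnessLib

/-!
# [IUTchI] Def 4.6 (iii) / Rmk 6.12.2 (i): the transport law `S5Local.GluingTransportLaw` is a SCHEMA over the
# ΘNF-side hypothesis kit `S5Local` — universal-closure certificate, binder-free (proof-only)

S. Mochizuki, *Inter-universal Teichmüller theory I: construction of Hodge theaters*, kurims manuscript (May 2020),
Def 4.6 (iii) p. 112 («there exist isomorphisms `𝒟^⊚ ⥲ †𝒟^⊚`; `𝔇_⋆ ⥲ †𝔇_J`; `𝔇_> ⥲ †𝔇_>`, conjugation by which maps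
`φ^{NF}_⋆ ↦ †φ^{NF}_⋆`, `φ^Θ_⋆ ↦ †φ^Θ_⋆`»), Example 4.3 (ii), (iii) p. 100 («the poly-morphism given by the collection of
morphisms `β ∘ φ^{NF}_{•,v} ∘ α` — where `α ∈ Aut(𝒟_v)` …»), Remark 6.12.2 (i) p. 174 («glued … via the functorial
algorithm of Proposition 6.7») [claim: Mochizuki2012, status: disputed] (D-0012 claim key; series status DISPUTED —
kernel theorems about abc-iut-L5-t4's INTERFACES `PMBaseKit` / `S5Local` and its consistency model `toyKit`; nothing of
the series is asserted, no side is taken on [IUTchIII] Cor. 3.12).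

abc-iut cell, FACT-LIST row **F-2736** (`PMBaseKit.S5Local.GluingTransportLaw`, `ThetaPMEllNFHodgeTheatersD.lean`), layer
L5, lane «KL5-CLOSURE-CERTS» (`plan/LF-KERNEL-STATUS.tsv`: mechanical class «?», «conditional instances 2: `toy`,
`gluingTransportLaw_ofDatum`» — the row had instance-form closers but no binder-free universal-closure decision); seat
abc-iut-L5-t13 gen 9 on gen 8's written recipe.  PROOF-ONLY, nothing re-typed, no `def`.

What is in tree: the law is a HYPOTHESIS structure on the kit `S5Local` (whose predicate `IsDThetaNFHT` — "forms a
`𝒟-ΘNF`-Hodge theater" — is a FREE field), with the consistency inhabitant `GluingTransportLaw.toy` (over `S5Local.toy`,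
where the predicate is `True`) and abc-iut-L5-t3's PROVED instance `BaseThetaDatum.S5Local.gluingTransportLaw_ofDatum`
for every Definition-5.5 kit `S5Local.ofDatum`, where the predicate MEANS "dictionary image of an honest §4
`𝒟-ΘNF`-Hodge theater" and NF poly-data absorb automorphisms as in print (also fired at the Θ-stand-in by abc-iut-f-193,
`PiAvatarKitCoreThetaGluingTransport`).  What the closure lane lacked is decided here, in the grammar of
`PMBaseXiGroupCompatClosureCertificate` / `PMBasePreciselyTwoPlusFullPolyAutClosureCertificate`:
* `S5Local.not_gluingTransportLaw_of_subsingleton` — WHICH DEGENERATION KILLS IT: for ANY kit whose predicate forces every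
  NF-datum to be a subsingleton, one gluing plus two isomorphisms onto the capsule object acting differently on one
  NF-morphism refute the law (the transported data `DThetaGluing.transportNF = {φ.hom ≫ f}` absorb the automorphisms of
  Proposition 6.7's capsule object; single-morphism NF-data cannot);
* `S5Local.exists_toyKit_not_gluingTransportLaw (l) (hl : l ≠ 2)` — COUNTERMODEL over `toyKit l hl` for every odd prime:
  the kit `S5Local.toy` with the predicate replaced by «`∀ j v, (nf j v).Subsingleton`» (built inside the proof term), the
  model bridge `Ex62.bridge`, Proposition 6.7's output glued by the identity (abc-iut-L5-t4's PROVED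
  `thetaBridgeData_aut_comp_eq_comp_aut`), singleton NF-data, and the negative automorphism `−1 ∈ Aut(𝒟_v) = ℤˣ` of the
  collage category, which moves a morphism `𝒟_v → 𝒟^{⊚}` inside `AGL₁(𝔽_l)` because `−1 ≠ 1` in `𝔽_l`;
* `S5Local.exists_not_gluingTransportLaw`, `S5Local.not_forall_gluingTransportLaw` — **F-2736's universal closure over the
  interface is FALSE**, no binder (`l = 3`, Mathlib `Nat.fact_prime_three`);
* `S5Local.exists_gluingTransportLaw`, `S5Local.gluingTransportLaw_schema` — and CONSISTENT, no binder
  (`GluingTransportLaw.toy 3`): **F-2736 is a SCHEMA**; its content is the instance form `gluingTransportLaw_ofDatum`.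
HONEST FRAMING: the refuted universal closure is a statement about OUR typing — the kit leaves `IsDThetaNFHT` free, so a
kit may declare NF poly-data to be single morphisms; in print the `φ^{NF}_v` are `Aut`-saturated poly-morphisms (Example
4.3 (ii), (iii)) and the transport law is a consequence of Proposition 6.7, which is what `gluingTransportLaw_ofDatum`
proves for the honest kits.  refuted-as-typed ≠ refuted-in-print; typed ≠ inhabited ≠ proved; nothing here bears on
[IUTchIII] Cor. 3.12 or asserts anything about abc.
-/

namespace Literature.IUT.HodgeTheaters

open CategoryTheory

universe u

namespace PMBaseKit

namespace S5Local

variable {l : ℕ} {K : PMBaseKit.{u} l} {M : K.MultKit} {FK : K.FKit M} (N : K.S5Local M FK)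

/-! ## Which degeneration kills the law -/

/-- **Criterion (which degeneration kills `GluingTransportLaw`).** If the kit's predicate "forms a `𝒟-ΘNF`-Hodge theater"
forces every NF-datum to be a subsingleton, then any `𝒟`-level gluing `G` of a kit-form `𝒟-ΘNF`-Hodge theater `X` to a
`𝒟-Θ^±`-bridge `B` together with two isomorphisms `φ₁, φ₂` from Proposition 6.7's capsule object onto `X`'s capsule object
that act differently on one NF-morphism `f ∈ X.nfPoly` refutes the law: both composites `φᵢ.hom ≫ f` lie in the transported
NF-datum `G.transportNF` ([IUTchI] Rmk 6.12.2 (i) p. 174; in print the composites `β ∘ φ^{NF}_{•,v} ∘ α`, `α ∈ Aut(𝒟_v)`, of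
Example 4.3 (ii), (iii) p. 100 absorb such automorphisms). PROVED, any kit.
([IUTchI] Def 4.6 (iii) p.112) [claim: Mochizuki2012, status: disputed] -/
theorem not_gluingTransportLaw_of_subsingleton {hl : Odd l}
    (hN : ∀ (D : K.DThetaBridgeData) (Z : N.CatAmb) (nf : ∀ j v, Set ((D.capsule j).obj v ⟶ (N.nfAtV v).obj Z)),
      N.IsDThetaNFHT D Z nf → ∀ j v, (nf j v).Subsingleton)
    (B : K.DThetaPMBridge) (X : N.DNFHT) (G : N.DThetaGluing B X hl) (q : ULift.{u} B.grpT.AbsStar) (v : K.V)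
    (φ₁ φ₂ : (B.starCapsule q.down).obj v ≅ (X.thBridge.capsule (G.indexEquiv.symm q.down)).obj v)
    (f : (X.thBridge.capsule (G.indexEquiv.symm q.down)).obj v ⟶ (N.nfAtV v).obj X.glob)
    (hf : f ∈ X.nfPoly (G.indexEquiv.symm q.down) v) (hne : φ₁.hom ≫ f ≠ φ₂.hom ≫ f) :
    ¬ N.GluingTransportLaw hl := by
  intro law
  have hsub : (G.transportNF q v).Subsingleton := hN _ _ _ (law.isDThetaNFHT_transport B X G) q v
  have h₁ : φ₁.hom ≫ f ∈ G.transportNF q v := ⟨φ₁, f, hf, rfl⟩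
  have h₂ : φ₂.hom ≫ f ∈ G.transportNF q v := ⟨φ₂, f, hf, rfl⟩
  exact hne (hsub h₁ h₂)

/-! ## The countermodel over the consistency kit `toyKit` -/

/-- **F-2736, refuting instance over `toyKit l hl` for every prime `l ≠ 2`.** The ΘNF-side kit `S5Local.toy` with its free
predicate `IsDThetaNFHT` replaced by «every NF-datum is a subsingleton» violates the transport law: glue Proposition 6.7's
output of the model `𝒟-Θ^±`-bridge `Ex62.bridge` ([IUTchI] Ex 6.2 (i)) to itself by the identity (a gluing, by abc-iut-L5-t4's
`thetaBridgeData_aut_comp_eq_comp_aut`), with one NF-morphism `𝒟_v → 𝒟^⊚` per constituent; the negative automorphism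
`−1 ∈ Aut(𝒟_v) = ℤˣ` of the collage category moves that morphism inside `Hom(𝒟_v, 𝒟^⊚) = AGL₁(𝔽_l)` since `−1 ≠ 1` in `𝔽_l`,
so the transported datum has two elements ([IUTchI] Rmk 6.12.2 (i) p. 174; Def 4.6 (iii) p. 112).
([IUTchI] Def 4.6 (iii) p.112) [claim: Mochizuki2012, status: disputed] -/
theorem exists_toyKit_not_gluingTransportLaw (l : ℕ) [Fact l.Prime] (hl : l ≠ 2) (hlo : Odd l) :
    ∃ N : (toyKit l hl).S5Local (MultKit.toy l hl) (FKit.toy l hl), ¬ N.GluingTransportLaw hlo := by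
  haveI : NeZero l := ⟨(Fact.out : l.Prime).ne_zero⟩
  haveI : Fact (2 < l) := ⟨lt_of_le_of_ne (Fact.out : l.Prime).two_le (Ne.symm hl)⟩
  -- the kit: `S5Local.toy` with "forms a 𝒟-ΘNF-Hodge theater" := "every NF-datum is a subsingleton"
  let N : (toyKit l hl).S5Local (MultKit.toy l hl) (FKit.toy l hl) :=
    { CatAmb := SingleObj (Model.AGL l)
      nfAtV := fun _ => Model.atV' l
      IsDThetaNFHT := fun _ _ nf => ∀ j v, (nf j v).Subsingleton
      ThetaNFHT := PUnit
      thJ := fun _ => PEmpty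
      thCapsule := fun _ j => j.elim
      thFgt := fun _ => ⟨fun _ => Model.Obj.loc, fun _ => ⟨Iso.refl _⟩⟩
      thDPoly := fun _ j => j.elim }
  refine ⟨N, ?_⟩
  -- the `𝒟-Θ^±`-bridge of Example 6.2 (i) over the toy kit, and Proposition 6.7's output
  let B : (toyKit l hl).DThetaPMBridge := Ex62.bridge (toyKit l hl)
  -- one NF-morphism `𝒟_v → 𝒟^⊚` on each constituent of Proposition 6.7's capsule: the unit of `AGL₁(𝔽_l)`
  let f₀ : ∀ (q : ULift.{0} B.grpT.AbsStar) (v : (toyKit l hl).V),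
      ((B.thetaBridgeData (MultKit.toy l hl) hlo).capsule q).obj v ⟶ (N.nfAtV v).obj (SingleObj.star (Model.AGL l)) :=
    fun _ _ => ((1 : Model.AGL l) : Model.Obj.loc ⟶ Model.Obj.glob)
  let X : N.DNFHT :=
    ⟨B.thetaBridgeData (MultKit.toy l hl) hlo, SingleObj.star (Model.AGL l), fun q v => {f₀ q v},
      fun q v => Set.subsingleton_singleton⟩
  -- the identity gluing (Proposition 6.7's poly-morphisms absorb automorphisms on either side)
  let G : N.DThetaGluing B X hlo :=
    { indexEquiv := Equiv.ulift
      compat := fun j v => B.thetaBridgeData_aut_comp_eq_comp_aut (M := MultKit.toy l hl) hlo j v }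
  -- the constituent labelled by the `±`-canonical class, at the one valuation
  let q : ULift.{0} B.grpT.AbsStar := ⟨B.grpT.etaPMAbs⟩
  let v : (toyKit l hl).V := PUnit.unit
  -- the negative automorphism `−1 ∈ Aut(𝒟_v) = ℤˣ` of the constituent
  let φneg : (B.starCapsule q.down).obj v ≅ (X.thBridge.capsule (G.indexEquiv.symm q.down)).obj v :=
    { hom := ((-1 : ℤˣ) : Model.Obj.loc ⟶ Model.Obj.loc)
      inv := ((-1 : ℤˣ) : Model.Obj.loc ⟶ Model.Obj.loc)
      hom_inv_id := by change (-1 : ℤˣ) * (-1) = 1; simp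
      inv_hom_id := by change (-1 : ℤˣ) * (-1) = 1; simp }
  refine N.not_gluingTransportLaw_of_subsingleton (fun _ _ _ h => h) B X G q v (Iso.refl _) φneg (f₀ q v) rfl ?_
  -- `𝟙 ≫ f₀ = 1 · (+1)` versus `(−1) ≫ f₀ = 1 · (−1)` in `AGL₁(𝔽_l)`
  intro h
  change (1 : Model.AGL l) * Model.signToAGL l 1 = (1 : Model.AGL l) * Model.signToAGL l (-1) at h
  have h' : Model.signToAGL l (-1) = 1 := by simpa using h.symm
  have h2 : ((Model.signToAGL l (-1)).right : ZMod l) = ((1 : Model.AGL l).right : ZMod l) := by rw [h']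
  simp [Model.signToAGL] at h2
  exact ZMod.neg_one_ne_one h2

/-! ## F-2736 `S5Local.GluingTransportLaw`: consistent ∧ independent, binder-free -/

/-- **F-2736, refuting instance with no binder**: there are a prime `l` (namely `3`), kits `K, M, FK` and a ΘNF-side kit
`N` over them for which the transport law FAILS (`exists_toyKit_not_gluingTransportLaw` at `l = 3`).
([IUTchI] Def 4.6 (iii) p.112) [claim: Mochizuki2012, status: disputed] -/
theorem exists_not_gluingTransportLaw :
    ∃ (l : ℕ) (_ : Fact l.Prime) (K : PMBaseKit.{0} l) (M : K.MultKit) (FK : K.FKit M) (N : K.S5Local M FK)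
      (hl : Odd l), ¬ N.GluingTransportLaw hl := by
  haveI : Fact (Nat.Prime 3) := Nat.fact_prime_three
  obtain ⟨N, hN⟩ := exists_toyKit_not_gluingTransportLaw 3 (by decide) (by decide)
  exact ⟨3, inferInstance, _, _, _, N, _, hN⟩

/-- **F-2736: the universal closure of `S5Local.GluingTransportLaw` over the interface is FALSE** — Def 4.6 (iii)'s
iso-invariance AS TYPED over the free predicate `IsDThetaNFHT` of the kit `S5Local` is not a theorem of the interface.
([IUTchI] Def 4.6 (iii) p.112) [claim: Mochizuki2012, status: disputed] -/
theorem not_forall_gluingTransportLaw :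
    ¬ ∀ (l : ℕ) (_ : Fact l.Prime) (K : PMBaseKit.{0} l) (M : K.MultKit) (FK : K.FKit M) (N : K.S5Local M FK)
      (hl : Odd l), N.GluingTransportLaw hl := fun h => by
  obtain ⟨l, hp, K, M, FK, N, hl, hN⟩ := exists_not_gluingTransportLaw
  exact hN (h l hp K M FK N hl)

/-- **F-2736, satisfying instance with no binder**: over the consistency kits `toyKit 3`, `MultKit.toy 3`, `FKit.toy 3`
the ΘNF-side kit `S5Local.toy 3` (predicate `True`) satisfies the transport law (`GluingTransportLaw.toy`).
([IUTchI] Def 4.6 (iii) p.112) [claim: Mochizuki2012, status: disputed] -/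
theorem exists_gluingTransportLaw :
    ∃ (l : ℕ) (_ : Fact l.Prime) (K : PMBaseKit.{0} l) (M : K.MultKit) (FK : K.FKit M) (N : K.S5Local M FK)
      (hl : Odd l), N.GluingTransportLaw hl := by
  haveI : Fact (Nat.Prime 3) := Nat.fact_prime_three
  exact ⟨3, inferInstance, _, _, _, S5Local.toy 3 (by decide), by decide,
    GluingTransportLaw.toy 3 (by decide) (by decide)⟩

/-- **F-2736 is a SCHEMA** (consistent ∧ independent over the interface, hypothesis-free); its content is the instance
form `BaseThetaDatum.S5Local.gluingTransportLaw_ofDatum` (abc-iut-L5-t3) for the honest Definition-5.5 kits, where NF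
poly-data absorb automorphisms as in [IUTchI] Example 4.3 (ii), (iii).
([IUTchI] Def 4.6 (iii) p.112) [claim: Mochizuki2012, status: disputed] -/
theorem gluingTransportLaw_schema :
    (∃ (l : ℕ) (_ : Fact l.Prime) (K : PMBaseKit.{0} l) (M : K.MultKit) (FK : K.FKit M) (N : K.S5Local M FK)
        (hl : Odd l), N.GluingTransportLaw hl) ∧
      ∃ (l : ℕ) (_ : Fact l.Prime) (K : PMBaseKit.{0} l) (M : K.MultKit) (FK : K.FKit M) (N : K.S5Local M FK)
        (hl : Odd l), ¬ N.GluingTransportLaw hl :=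
  ⟨exists_gluingTransportLaw, exists_not_gluingTransportLaw⟩

end S5Local

end PMBaseKit

end Literature.IUT.HodgeTheaters
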